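import Mathlib
import Literature.NumberTheory.LFunctions.Zhang2022.Section7Eq77Lemmas
import Literature.NumberTheory.LFunctions.Zhang2022.Section14Eq143Core
import Literature.NumberTheory.LFunctions.Zhang2022.Section7I1Line
import HarnessLib

/-!
# Zhang (2022) §7 p. 36: the two unprinted error estimates behind (7.7) and tex L1944
# (`E₇₇` "by Lemma 5.4", `F₇₇` "by trivial estimation") — PROVED; hence `Z22:(7.7)` and the
# tex-L1944 sentence (cone leaf `h1944`) hold OUTRIGHT

Topic `Literature/NumberTheory/LFunctions/Zhang2022` (Landau–Siegel audit tree; verdict-neutral).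
Y. Zhang, *Discrete mean estimates and the Landau–Siegel zero*, arXiv:2211.02515v1 (2022)
[Zhang2022LandauSiegel] — **an unrefereed manuscript under adjudication; nothing here asserts or
denies its Theorems 1–2.** Campaign D-0069 (discharge lane, layer L2, seat d23); THEOREM-ONLY, no
fact beyond Mathlib and tree theorems (Lemma 5.3 = the tree's DISCHARGED `Skeleton.lemma53_holds`).

§7 p. 36 (tex L1935–L1944): "Hence, by Lemma 5.4, [(7.7)]. By trivial estimation, this remains valid
if the constraint `(l,p) = 1` is removed." The tree's `Section7bDischarges` (L2-t3, rev7) reduced both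
sentences to two EXPLICIT error sums — `eq77_of : Step7u022 c′ → hE → Eq77 c′`, `hE` = "`p⁻¹E₇₇ =
O(PT⁻ᶜ)`", `E₇₇ = Σ_{d<PT⁻²} d⁻¹Σ_{(l,p)=1}Σ_{k<PT⁻²,(k,l)=1}(κ∗a₁)(dl)a₂(dk)k⁻¹(1 − e(lk̄/p))Δ₁(l/(pk))`,
and `step7t1944_of : Eq77 c′ → hF → Step7t1944 c′`, `hF` = "`F₇₇ = O(PT⁻ᶜ)`", `F₇₇` = the same sum
over `p ∣ l` with weight `e(lk̄/p)`. This file PROVES `hE` and `hF` for every `c′` and `B` (`c = 1`,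
`C = 1`) by term-by-term absolute estimation (no Mellin transform): `|(κ∗a₁)(m)| ≤ Bτ₅(m) ≤ B·d(m)⁴`
(tree `Section7aStatements.norm_kconv_le_tau_five`), `d(dl) ≤ d(d)d(l)`, `|1 − e(lk̄/p)| ≤ 2`,
`|Δ₁| = |Δ|`, and the **window lemma** of the §14 lane (`Typed.Sec14.tsum_divisors_pow_mul_norm_DeltaW_le`,
sz-d31: `Σ_l d(l)⁴|Δ(l/X)| ≤ K_W·X·𝓛⁶⁷⁴`, `1 ≤ X`, `log X ≤ 5𝓛⁹`, Lemma 5.3 inside) at `X = pk` (for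
`E₇₇`; `pk` cancels against `p⁻¹k⁻¹`) resp. at `X = k` after writing `l = pl′` (for `F₇₇`; `d(p) = 2`);
then `Σ_{k<PT⁻²} 1 ≤ PT⁻²`, `Σ_{d<PT⁻²} d(d)⁴/d ≤ 2¹⁶𝓛¹⁴⁴` (tree `sum_card_divisors_pow_div_le_log_pow`),
so both sums are `≤ 2²⁰B²K_W𝓛⁸¹⁸·PT⁻² ≤ PT⁻¹` once `2²⁰B²K_W𝓛⁸¹⁸ ≤ T` (`pow_le_bigT`); (A), `χ` unused.

| decl | content |
|---|---|
| `inner_E_le`, `inner_F_le` | the `l,k`-sums at fixed `d` (elementary lemmas: `Section7Eq77Lemmas`) |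
| **`hE77_holds`**, **`hF77_holds`** | the hypotheses `hE` of `eq77_of` and `hF` of `step7t1944_of`, verbatim |
| **`eq77_holds`**, **`step7t1944_holds`** | `Z22:(7.7)` = `Eq77 c′` and tex L1944 = `Step7t1944 c′` (cone leaf `h1944`) OUTRIGHT |

## References

* Y. Zhang, arXiv:2211.02515v1 (2022), §7 (7.7) p. 36, tex L1935–L1944; §5 Lemma 5.3 p. 25.
  [cite: Zhang2022LandauSiegel, §7 (7.7) p.36 tex L1935–L1944]
-/

noncomputable section

open Complex Real Finset

namespace Literature.NumberTheory.LFunctions.Zhang2022.Section7Eq77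

open Skeleton Section7bStatements

variable (c' : ℝ)

/-! ## The `(l,k)`-sums at fixed `d` -/

/-- **The `E₇₇` sum at fixed `d`** (the `(l,p) = 1` terms with the weight `1 − e(lk̄/p)`, tex
L1935–L1942): for `p ∼ P`, `|a₁|, |a₂| ≤ B` and Lemma 5.3 at `D` (`𝓛 ≥ 3`),
`|Σ_l Σ_{k<PT⁻²,(k,l)=1} (κ∗a₁)(dl)a₂(dk)k⁻¹(1 − e(lk̄/p))Δ₁(l/(pk))| ≤ 2B²K_W𝓛⁶⁷⁴·p·d(d)⁴·#{k < PT⁻²}`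
— term by term `|·| ≤ B d(d)⁴d(l)⁴·B k⁻¹·2·|Δ(l/(pk))|` and the window lemma at `X = pk`.
[cite: Zhang2022LandauSiegel, §7 (7.7) p. 36, tex L1935–L1942] -/
theorem inner_E_le {D : ℕ} {c C : ℝ} (hc : 0 ≤ c) (hC : 0 ≤ C) (hℓ3 : 3 ≤ ell D)
    (h53 : ∀ x : ℝ, 0 < x →
      (x ≤ t0 D ^ (1.02 : ℝ) → ‖DeltaW D x - omegaW D (1 / 2 + 2 * π * x * I)‖ ≤
          C * alpha D * ‖omegaW D (1 / 2 + 2 * π * x * I)‖ + Real.exp (-c * ell D ^ 10)) ∧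
      (t0 D ^ (1.02 : ℝ) < x → ‖DeltaW D x‖ ≤
        C * (Real.exp (-((1 : ℝ) / 100 * ell2 D * Real.log x) ^ 2) +
          Real.exp (-(x ^ (0.99 : ℝ)) / ell2 D))))
    {B : ℝ} {a₁ a₂ : ℕ → ℂ} (ha₁ : ∀ n, ‖a₁ n‖ ≤ B) (ha₂ : ∀ n, ‖a₂ n‖ ≤ B)
    {p : ℕ} (hp : p ∈ primeWindow D) (d : ℕ) :
    ‖∑' l : ℕ, ∑ k ∈ (Finset.Ico 1 (Skeleton.Nsupp D)).filter (fun k => Nat.Coprime k l),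
        if Nat.Coprime l p then
          kappaConv c' D a₁ (d * l) * a₂ (d * k) / (k : ℂ) *
            (1 - Complex.exp (2 * π * I *
              ((l : ℂ) * (((k : ZMod p)⁻¹).val : ℂ) / (p : ℂ)))) *
            Iface.Delta1W D ((l : ℝ) / ((p : ℝ) * k))
        else 0‖ ≤
      2 * B ^ 2 * ((2 * C + 3) * 7 ^ 16 + 4 * C) * ell D ^ 674 * p *
        (d.divisors.card : ℝ) ^ 4 * ((Finset.Ico 1 (Skeleton.Nsupp D)).card : ℝ) := by
  have hℓ1 : 1 ≤ ell D := by linarith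
  have hB0 : 0 ≤ B := (norm_nonneg _).trans (ha₁ 0)
  have hprime : p.Prime := (Finset.mem_filter.mp hp).2
  have hp1 : (1 : ℝ) ≤ p := by exact_mod_cast hprime.one_lt.le
  have hp0 : (0 : ℝ) < p := by linarith
  have hp2P : (p : ℝ) < 2 * bigP D := Section7MainTerm.lt_two_mul_bigP_of_mem_primeWindow hℓ1 hp
  set W : ℝ := (2 * C + 3) * 7 ^ 16 + 4 * C with hW
  have hW0 : 0 ≤ W := by rw [hW]; positivity
  set Ik := Finset.Ico 1 (Skeleton.Nsupp D) with hIk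
  set cd : ℝ := (d.divisors.card : ℝ) ^ 4 with hcd
  have hcd0 : 0 ≤ cd := by rw [hcd]; positivity
  -- the window lemma at `X = pk`, `k ∈ Ik`
  have hwin : ∀ k ∈ Ik,
      Summable (fun l : ℕ => (l.divisors.card : ℝ) ^ 4 * ‖DeltaW D ((l : ℝ) / ((p : ℝ) * k))‖) ∧
        ∑' l : ℕ, (l.divisors.card : ℝ) ^ 4 * ‖DeltaW D ((l : ℝ) / ((p : ℝ) * k))‖ ≤
          W * ((p : ℝ) * k) * ell D ^ 674 := by
    intro k hk
    obtain ⟨hk1, hkP⟩ := bounds_of_mem_Ico_Nsupp hk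
    exact window_at hc hC hℓ3 h53 hp1 hp2P.le hk1 hkP
  -- the majorant
  set G : ℕ → ℝ := fun l => ∑ k ∈ Ik, (2 * B ^ 2 * cd / k) *
      ((l.divisors.card : ℝ) ^ 4 * ‖DeltaW D ((l : ℝ) / ((p : ℝ) * k))‖) with hG
  have hGsum : Summable G := summable_sum fun k hk => (hwin k hk).1.mul_left _
  have hGeq : ∑' l : ℕ, G l = ∑ k ∈ Ik, (2 * B ^ 2 * cd / k) *
      ∑' l : ℕ, (l.divisors.card : ℝ) ^ 4 * ‖DeltaW D ((l : ℝ) / ((p : ℝ) * k))‖ := by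
    rw [hG, Summable.tsum_finsetSum (fun k hk => (hwin k hk).1.mul_left _)]
    exact Finset.sum_congr rfl fun k _ => tsum_mul_left
  -- pointwise domination
  have hpt : ∀ l : ℕ, ‖∑ k ∈ Ik.filter (fun k => Nat.Coprime k l),
      (if Nat.Coprime l p then
          kappaConv c' D a₁ (d * l) * a₂ (d * k) / (k : ℂ) *
            (1 - Complex.exp (2 * π * I *
              ((l : ℂ) * (((k : ZMod p)⁻¹).val : ℂ) / (p : ℂ)))) *
            Iface.Delta1W D ((l : ℝ) / ((p : ℝ) * k))
        else 0)‖ ≤ G l := by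
    intro l
    refine (norm_sum_le _ _).trans ?_
    refine (Finset.sum_le_sum_of_subset_of_nonneg (Finset.filter_subset _ Ik)
      (fun _ _ _ => norm_nonneg _)).trans ?_
    refine Finset.sum_le_sum fun k hk => ?_
    obtain ⟨hk1, -⟩ := bounds_of_mem_Ico_Nsupp hk
    have hk0 : (0 : ℝ) < k := by linarith
    have hrhs0 : 0 ≤ (2 * B ^ 2 * cd / k) *
        ((l.divisors.card : ℝ) ^ 4 * ‖DeltaW D ((l : ℝ) / ((p : ℝ) * k))‖) := by positivity
    by_cases hlp : Nat.Coprime l p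
    · rw [if_pos hlp, norm_mul, norm_mul, norm_div, norm_mul, Complex.norm_natCast,
        norm_Delta1W_eq]
      have hκ : ‖kappaConv c' D a₁ (d * l)‖ ≤ B * (cd * (l.divisors.card : ℝ) ^ 4) := by
        refine (norm_kappaConv_le_card c' ha₁ (d * l)).trans (mul_le_mul_of_nonneg_left ?_ hB0)
        rw [hcd, ← mul_pow]
        exact pow_le_pow_left₀ (Nat.cast_nonneg _)
          (by exact_mod_cast Sieve.DFI1995.card_divisors_mul_le d l) 4
      have ha : ‖a₂ (d * k)‖ ≤ B := ha₂ _
      have he : ‖1 - Complex.exp (2 * π * I *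
          ((l : ℂ) * (((k : ZMod p)⁻¹).val : ℂ) / (p : ℂ)))‖ ≤ 2 := norm_one_sub_exp_twist_le _ _ _
      have hΔ0 : 0 ≤ ‖DeltaW D ((l : ℝ) / ((p : ℝ) * k))‖ := norm_nonneg _
      calc ‖kappaConv c' D a₁ (d * l)‖ * ‖a₂ (d * k)‖ / (k : ℝ) *
            ‖1 - Complex.exp (2 * π * I * ((l : ℂ) * (((k : ZMod p)⁻¹).val : ℂ) / (p : ℂ)))‖ *
            ‖DeltaW D ((l : ℝ) / ((p : ℝ) * k))‖
          ≤ B * (cd * (l.divisors.card : ℝ) ^ 4) * B / (k : ℝ) * 2 *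
              ‖DeltaW D ((l : ℝ) / ((p : ℝ) * k))‖ := by
            have h1 : ‖kappaConv c' D a₁ (d * l)‖ * ‖a₂ (d * k)‖ ≤
                B * (cd * (l.divisors.card : ℝ) ^ 4) * B :=
              mul_le_mul hκ ha (norm_nonneg _) (by positivity)
            have h2 : ‖kappaConv c' D a₁ (d * l)‖ * ‖a₂ (d * k)‖ / (k : ℝ) ≤
                B * (cd * (l.divisors.card : ℝ) ^ 4) * B / (k : ℝ) :=
              div_le_div_of_nonneg_right h1 hk0.le
            exact mul_le_mul_of_nonneg_right
              (mul_le_mul h2 he (norm_nonneg _) (by positivity)) hΔ0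
        _ = (2 * B ^ 2 * cd / k) *
              ((l.divisors.card : ℝ) ^ 4 * ‖DeltaW D ((l : ℝ) / ((p : ℝ) * k))‖) := by ring
    · rw [if_neg hlp, norm_zero]
      exact hrhs0
  -- sum the majorant
  have hP0 : 0 ≤ (p : ℝ) := hp0.le
  calc _ ≤ ∑' l : ℕ, G l := tsum_of_norm_bounded hGsum.hasSum hpt
    _ = ∑ k ∈ Ik, (2 * B ^ 2 * cd / k) *
          ∑' l : ℕ, (l.divisors.card : ℝ) ^ 4 * ‖DeltaW D ((l : ℝ) / ((p : ℝ) * k))‖ := hGeq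
    _ ≤ ∑ k ∈ Ik, (2 * B ^ 2 * cd / k) * (W * ((p : ℝ) * k) * ell D ^ 674) := by
        refine Finset.sum_le_sum fun k hk => ?_
        obtain ⟨hk1, -⟩ := bounds_of_mem_Ico_Nsupp hk
        exact mul_le_mul_of_nonneg_left (hwin k hk).2 (by positivity)
    _ = ∑ k ∈ Ik, 2 * B ^ 2 * W * ell D ^ 674 * p * cd := by
        refine Finset.sum_congr rfl fun k hk => ?_
        obtain ⟨hk1, -⟩ := bounds_of_mem_Ico_Nsupp hk
        have hk0 : (k : ℝ) ≠ 0 := by positivity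
        field_simp
    _ = 2 * B ^ 2 * W * ell D ^ 674 * p * cd * (Ik.card : ℝ) := by
        rw [Finset.sum_const, nsmul_eq_mul]; ring


/-- **The `F₇₇` sum at fixed `d`** (the `p ∣ l` terms, tex L1944 "trivial estimation"): for
`p ∼ P`, `|a₁|, |a₂| ≤ B` and Lemma 5.3 at `D` (`𝓛 ≥ 3`),
`|Σ_{p∣l} Σ_{k<PT⁻²,(k,l)=1} (κ∗a₁)(dl)a₂(dk)k⁻¹e(lk̄/p)Δ₁(l/(pk))| ≤ 16B²K_W𝓛⁶⁷⁴·d(d)⁴·#{k < PT⁻²}`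
— write `l = pl′` (so `Δ₁(l/(pk)) = Δ₁(l′/k)`, `d(dpl′) ≤ 2d(d)d(l′)`) and use the window lemma
at `X = k`. [cite: Zhang2022LandauSiegel, §7 p. 36, tex L1944] -/
theorem inner_F_le {D : ℕ} {c C : ℝ} (hc : 0 ≤ c) (hC : 0 ≤ C) (hℓ3 : 3 ≤ ell D)
    (h53 : ∀ x : ℝ, 0 < x →
      (x ≤ t0 D ^ (1.02 : ℝ) → ‖DeltaW D x - omegaW D (1 / 2 + 2 * π * x * I)‖ ≤
          C * alpha D * ‖omegaW D (1 / 2 + 2 * π * x * I)‖ + Real.exp (-c * ell D ^ 10)) ∧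
      (t0 D ^ (1.02 : ℝ) < x → ‖DeltaW D x‖ ≤
        C * (Real.exp (-((1 : ℝ) / 100 * ell2 D * Real.log x) ^ 2) +
          Real.exp (-(x ^ (0.99 : ℝ)) / ell2 D))))
    {B : ℝ} {a₁ a₂ : ℕ → ℂ} (ha₁ : ∀ n, ‖a₁ n‖ ≤ B) (ha₂ : ∀ n, ‖a₂ n‖ ≤ B)
    {p : ℕ} (hp : p ∈ primeWindow D) (d : ℕ) :
    ‖∑' l : ℕ, ∑ k ∈ (Finset.Ico 1 (Skeleton.Nsupp D)).filter (fun k => Nat.Coprime k l),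
        if Nat.Coprime l p then 0 else
          kappaConv c' D a₁ (d * l) * a₂ (d * k) / (k : ℂ) *
            Complex.exp (2 * π * I * ((l : ℂ) * (((k : ZMod p)⁻¹).val : ℂ) / (p : ℂ))) *
            Iface.Delta1W D ((l : ℝ) / ((p : ℝ) * k))‖ ≤
      16 * B ^ 2 * ((2 * C + 3) * 7 ^ 16 + 4 * C) * ell D ^ 674 *
        (d.divisors.card : ℝ) ^ 4 * ((Finset.Ico 1 (Skeleton.Nsupp D)).card : ℝ) := by
  have hℓ1 : 1 ≤ ell D := by linarith
  have hB0 : 0 ≤ B := (norm_nonneg _).trans (ha₁ 0)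
  have hprime : p.Prime := (Finset.mem_filter.mp hp).2
  have hpne : p ≠ 0 := hprime.ne_zero
  have hp1 : (1 : ℝ) ≤ p := by exact_mod_cast hprime.one_lt.le
  have hp0 : (0 : ℝ) < p := by linarith
  have hP1 : (1 : ℝ) ≤ 2 * bigP D := by
    have : (1 : ℝ) ≤ bigP D := by rw [bigP]; exact Real.one_le_exp (by positivity)
    linarith
  set W : ℝ := (2 * C + 3) * 7 ^ 16 + 4 * C with hW
  have hW0 : 0 ≤ W := by rw [hW]; positivity
  set Ik := Finset.Ico 1 (Skeleton.Nsupp D) with hIk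
  set cd : ℝ := (d.divisors.card : ℝ) ^ 4 with hcd
  have hcd0 : 0 ≤ cd := by rw [hcd]; positivity
  -- the summand as a function of `l`, supported on the multiples of `p`
  set F : ℕ → ℂ := fun l => ∑ k ∈ Ik.filter (fun k => Nat.Coprime k l),
      (if Nat.Coprime l p then 0 else
        kappaConv c' D a₁ (d * l) * a₂ (d * k) / (k : ℂ) *
          Complex.exp (2 * π * I * ((l : ℂ) * (((k : ZMod p)⁻¹).val : ℂ) / (p : ℂ))) *
          Iface.Delta1W D ((l : ℝ) / ((p : ℝ) * k))) with hF
  have hsupp : Function.support F ⊆ Set.range (fun l' : ℕ => p * l') := by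
    intro l hl
    rw [Function.mem_support] at hl
    have hlp : ¬ Nat.Coprime l p := by
      intro hco
      apply hl
      rw [hF]
      exact Finset.sum_eq_zero fun k _ => by rw [if_pos hco]
    have hdvd : p ∣ l := by
      rw [Nat.coprime_comm, hprime.coprime_iff_not_dvd, not_not] at hlp
      exact hlp
    obtain ⟨l', rfl⟩ := hdvd
    exact ⟨l', rfl⟩
  have hinj : Function.Injective (fun l' : ℕ => p * l') := mul_right_injective₀ hpne
  have hreidx : ∑' l : ℕ, F l = ∑' l' : ℕ, F (p * l') := (hinj.tsum_eq hsupp).symm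
  -- the window lemma at `X = k`, `k ∈ Ik`
  have hwin : ∀ k ∈ Ik,
      Summable (fun l : ℕ => (l.divisors.card : ℝ) ^ 4 * ‖DeltaW D ((l : ℝ) / ((1 : ℝ) * k))‖) ∧
        ∑' l : ℕ, (l.divisors.card : ℝ) ^ 4 * ‖DeltaW D ((l : ℝ) / ((1 : ℝ) * k))‖ ≤
          W * ((1 : ℝ) * k) * ell D ^ 674 := by
    intro k hk
    obtain ⟨hk1, hkP⟩ := bounds_of_mem_Ico_Nsupp hk
    exact window_at hc hC hℓ3 h53 le_rfl hP1 hk1 hkP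
  -- the majorant of `l' ↦ F (p l')`
  set H : ℕ → ℝ := fun l' => ∑ k ∈ Ik, (16 * B ^ 2 * cd / k) *
      ((l'.divisors.card : ℝ) ^ 4 * ‖DeltaW D ((l' : ℝ) / ((1 : ℝ) * k))‖) with hH
  have hHsum : Summable H := summable_sum fun k hk => (hwin k hk).1.mul_left _
  have hHeq : ∑' l' : ℕ, H l' = ∑ k ∈ Ik, (16 * B ^ 2 * cd / k) *
      ∑' l' : ℕ, (l'.divisors.card : ℝ) ^ 4 * ‖DeltaW D ((l' : ℝ) / ((1 : ℝ) * k))‖ := by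
    rw [hH, Summable.tsum_finsetSum (fun k hk => (hwin k hk).1.mul_left _)]
    exact Finset.sum_congr rfl fun k _ => tsum_mul_left
  -- pointwise domination `‖F (p l')‖ ≤ H l'`
  have hpt : ∀ l' : ℕ, ‖F (p * l')‖ ≤ H l' := by
    intro l'
    have hnc : ¬ Nat.Coprime (p * l') p := by
      rw [Nat.coprime_comm, hprime.coprime_iff_not_dvd, not_not]
      exact dvd_mul_right p l'
    rw [hF]
    simp only [if_neg hnc]
    refine (norm_sum_le _ _).trans ?_
    refine (Finset.sum_le_sum_of_subset_of_nonneg (Finset.filter_subset _ Ik)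
      (fun _ _ _ => norm_nonneg _)).trans ?_
    refine Finset.sum_le_sum fun k hk => ?_
    obtain ⟨hk1, -⟩ := bounds_of_mem_Ico_Nsupp hk
    have hk0 : (0 : ℝ) < k := by linarith
    rw [norm_mul, norm_mul, norm_div, norm_mul, Complex.norm_natCast, norm_Delta1W_eq,
      norm_exp_twist, mul_one]
    have harg : (((p * l' : ℕ) : ℝ) / ((p : ℝ) * k)) = ((l' : ℝ) / ((1 : ℝ) * k)) := by
      rw [Nat.cast_mul, one_mul, mul_div_mul_left _ _ hp0.ne']
    rw [harg]
    have hκ : ‖kappaConv c' D a₁ (d * (p * l'))‖ ≤ B * (16 * cd * (l'.divisors.card : ℝ) ^ 4) := by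
      refine (norm_kappaConv_le_card c' ha₁ _).trans (mul_le_mul_of_nonneg_left ?_ hB0)
      have h1 : (d * (p * l')).divisors.card ≤ d.divisors.card * (2 * l'.divisors.card) := by
        refine (Sieve.DFI1995.card_divisors_mul_le d (p * l')).trans (Nat.mul_le_mul_left _ ?_)
        have hcp : p.divisors.card = 2 := by rw [hprime.divisors, Finset.card_pair hprime.one_lt.ne]
        rw [← hcp]
        exact Sieve.DFI1995.card_divisors_mul_le p l'
      have h2 : ((d * (p * l')).divisors.card : ℝ) ≤ (d.divisors.card : ℝ) * (2 * l'.divisors.card) := by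
        exact_mod_cast h1
      calc ((d * (p * l')).divisors.card : ℝ) ^ 4
          ≤ ((d.divisors.card : ℝ) * (2 * l'.divisors.card)) ^ 4 :=
            pow_le_pow_left₀ (Nat.cast_nonneg _) h2 4
        _ = 16 * cd * (l'.divisors.card : ℝ) ^ 4 := by rw [hcd]; ring
    have ha : ‖a₂ (d * k)‖ ≤ B := ha₂ _
    have hΔ0 : 0 ≤ ‖DeltaW D ((l' : ℝ) / ((1 : ℝ) * k))‖ := norm_nonneg _
    calc ‖kappaConv c' D a₁ (d * (p * l'))‖ * ‖a₂ (d * k)‖ / (k : ℝ) *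
          ‖DeltaW D ((l' : ℝ) / ((1 : ℝ) * k))‖
        ≤ B * (16 * cd * (l'.divisors.card : ℝ) ^ 4) * B / (k : ℝ) *
            ‖DeltaW D ((l' : ℝ) / ((1 : ℝ) * k))‖ := by
          have h1 : ‖kappaConv c' D a₁ (d * (p * l'))‖ * ‖a₂ (d * k)‖ ≤
              B * (16 * cd * (l'.divisors.card : ℝ) ^ 4) * B :=
            mul_le_mul hκ ha (norm_nonneg _) (by positivity)
          exact mul_le_mul_of_nonneg_right (div_le_div_of_nonneg_right h1 hk0.le) hΔ0
      _ = (16 * B ^ 2 * cd / k) *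
            ((l'.divisors.card : ℝ) ^ 4 * ‖DeltaW D ((l' : ℝ) / ((1 : ℝ) * k))‖) := by ring
  -- sum the majorant
  rw [hreidx]
  calc ‖∑' l' : ℕ, F (p * l')‖ ≤ ∑' l' : ℕ, H l' := tsum_of_norm_bounded hHsum.hasSum hpt
    _ = ∑ k ∈ Ik, (16 * B ^ 2 * cd / k) *
          ∑' l' : ℕ, (l'.divisors.card : ℝ) ^ 4 * ‖DeltaW D ((l' : ℝ) / ((1 : ℝ) * k))‖ := hHeq
    _ ≤ ∑ k ∈ Ik, (16 * B ^ 2 * cd / k) * (W * ((1 : ℝ) * k) * ell D ^ 674) := by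
        refine Finset.sum_le_sum fun k hk => ?_
        obtain ⟨hk1, -⟩ := bounds_of_mem_Ico_Nsupp hk
        exact mul_le_mul_of_nonneg_left (hwin k hk).2 (by positivity)
    _ = ∑ k ∈ Ik, 16 * B ^ 2 * W * ell D ^ 674 * cd := by
        refine Finset.sum_congr rfl fun k hk => ?_
        obtain ⟨hk1, -⟩ := bounds_of_mem_Ico_Nsupp hk
        have hk0 : (k : ℝ) ≠ 0 := by positivity
        field_simp
    _ = 16 * B ^ 2 * W * ell D ^ 674 * cd * (Ik.card : ℝ) := by
        rw [Finset.sum_const, nsmul_eq_mul]; ring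

/-! ## The two estimates -/

/-- **`p⁻¹E₇₇ = O(PT⁻¹)`** — the hypothesis `hE` of the tree's `Section7bStatements.eq77_of`
(L2-t3 rev7), VERBATIM, for every `c′` and every `B` (`c = 1`, `C = 1`): the estimate the source
assigns to "Lemma 5.4" in (7.7), proved by crude absolute estimation (`inner_E_le`, `outer_sum_le`,
`absorb_le`; Lemma 5.3 = `Skeleton.lemma53_holds`; (A) unused).
[cite: Zhang2022LandauSiegel, §7 (7.7) p. 36, tex L1935–L1942] -/
theorem hE77_holds (B : ℝ) : ∃ c : ℝ, 0 < c ∧ ∃ C : ℝ, Skeleton.ForAllLarge fun D _ χ =>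
    Skeleton.AssumptionA D χ → ∀ a₁ a₂ : ℕ → ℂ, Skeleton.Adm72 D B a₁ → Skeleton.Adm72 D B a₂ →
      ∀ p ∈ Skeleton.primeWindow D,
        ‖1 / (p : ℂ) * ∑ d ∈ Finset.Ico 1 (Skeleton.Nsupp D), 1 / (d : ℂ) *
            ∑' l : ℕ, ∑ k ∈ (Finset.Ico 1 (Skeleton.Nsupp D)).filter (fun k => Nat.Coprime k l),
              if Nat.Coprime l p then
                kappaConv c' D a₁ (d * l) * a₂ (d * k) / (k : ℂ) *
                  (1 - Complex.exp (2 * π * I *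
                    ((l : ℂ) * (((k : ZMod p)⁻¹).val : ℂ) / (p : ℂ)))) *
                  Iface.Delta1W D ((l : ℝ) / ((p : ℝ) * k))
              else 0‖ ≤ C * Skeleton.bigP D * Skeleton.bigT D ^ (-c) := by
  obtain ⟨c53, hc53, C53, D₅₃, h53⟩ := lemma53_holds
  set W : ℝ := (2 * max C53 0 + 3) * 7 ^ 16 + 4 * max C53 0 with hW
  have hC0 : 0 ≤ max C53 0 := le_max_right _ _
  have hW0 : 0 ≤ W := by rw [hW]; positivity
  obtain ⟨D₁, hD₁⟩ := Typed.Sec14.Eq143.pow_le_bigT 818 (2 ^ 17 * B ^ 2 * W)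
  obtain ⟨D₂, hD₂⟩ := Section7Eq75.exists_nat_le_ell 3
  refine ⟨1, one_pos, 1, max (max D₅₃ D₁) D₂, fun D _ χ hD hq hprim _ a₁ a₂ ha₁ ha₂ p hp => ?_⟩
  have hD₅₃ : D₅₃ ≤ D := le_trans (le_trans (le_max_left _ _) (le_max_left _ _)) hD
  have hD₁' : D₁ ≤ D := le_trans (le_trans (le_max_right _ _) (le_max_left _ _)) hD
  have hℓ3 : 3 ≤ ell D := hD₂ D (le_trans (le_max_right _ _) hD)
  have hℓ1 : 1 ≤ ell D := by linarith
  have h53D := l53_max (fun x hx => h53 D χ hD₅₃ hq hprim x hx)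
  have hprime : p.Prime := (Finset.mem_filter.mp hp).2
  have hp0 : (0 : ℝ) < p := by exact_mod_cast hprime.pos
  have hB0 : 0 ≤ B := (norm_nonneg _).trans (ha₁.1 0)
  -- the `d`-sum
  have hK0 : 0 ≤ 2 * B ^ 2 * W * ell D ^ 674 * p := by positivity
  have hsum := outer_sum_le hℓ1 hK0 _ fun d _ =>
    inner_E_le c' hc53.le hC0 hℓ3 h53D ha₁.1 ha₂.1 hp d
  rw [norm_mul, norm_div, norm_one, Complex.norm_natCast]
  calc 1 / (p : ℝ) * ‖∑ d ∈ Finset.Ico 1 (Skeleton.Nsupp D), 1 / (d : ℂ) * _‖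
      ≤ 1 / (p : ℝ) * (2 * B ^ 2 * W * ell D ^ 674 * p * (2 ^ 16 * ell D ^ 144) *
          (bigP D / bigT D ^ 2)) := mul_le_mul_of_nonneg_left hsum (by positivity)
    _ = 2 ^ 17 * B ^ 2 * W * ell D ^ 818 * (bigP D / bigT D ^ 2) := by
        field_simp
    _ ≤ 1 * bigP D * bigT D ^ (-(1 : ℝ)) := absorb_le (hD₁ D hD₁')

/-- **`F₇₇ = O(PT⁻¹)`** — the hypothesis `hF` of the tree's `Section7bStatements.step7t1944_of`
(L2-t3 rev7), VERBATIM, for every `c′` and every `B` (`c = 1`, `C = 1`): the "trivial estimation"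
of tex L1944 removing the constraint `(l,p) = 1`, proved by crude absolute estimation
(`inner_F_le`, `outer_sum_le`, `absorb_le`; (A) unused).
[cite: Zhang2022LandauSiegel, §7 p. 36, tex L1944] -/
theorem hF77_holds (B : ℝ) : ∃ c : ℝ, 0 < c ∧ ∃ C : ℝ, Skeleton.ForAllLarge fun D _ χ =>
    Skeleton.AssumptionA D χ → ∀ a₁ a₂ : ℕ → ℂ, Skeleton.Adm72 D B a₁ → Skeleton.Adm72 D B a₂ →
      ∀ p ∈ Skeleton.primeWindow D,
        ‖∑ d ∈ Finset.Ico 1 (Skeleton.Nsupp D), 1 / (d : ℂ) *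
            ∑' l : ℕ, ∑ k ∈ (Finset.Ico 1 (Skeleton.Nsupp D)).filter (fun k => Nat.Coprime k l),
              if Nat.Coprime l p then 0 else
                kappaConv c' D a₁ (d * l) * a₂ (d * k) / (k : ℂ) *
                  Complex.exp (2 * π * I * ((l : ℂ) * (((k : ZMod p)⁻¹).val : ℂ) / (p : ℂ))) *
                  Iface.Delta1W D ((l : ℝ) / ((p : ℝ) * k))‖
          ≤ C * Skeleton.bigP D * Skeleton.bigT D ^ (-c) := by
  obtain ⟨c53, hc53, C53, D₅₃, h53⟩ := lemma53_holds
  set W : ℝ := (2 * max C53 0 + 3) * 7 ^ 16 + 4 * max C53 0 with hW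
  have hC0 : 0 ≤ max C53 0 := le_max_right _ _
  have hW0 : 0 ≤ W := by rw [hW]; positivity
  obtain ⟨D₁, hD₁⟩ := Typed.Sec14.Eq143.pow_le_bigT 818 (2 ^ 20 * B ^ 2 * W)
  obtain ⟨D₂, hD₂⟩ := Section7Eq75.exists_nat_le_ell 3
  refine ⟨1, one_pos, 1, max (max D₅₃ D₁) D₂, fun D _ χ hD hq hprim _ a₁ a₂ ha₁ ha₂ p hp => ?_⟩
  have hD₅₃ : D₅₃ ≤ D := le_trans (le_trans (le_max_left _ _) (le_max_left _ _)) hD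
  have hD₁' : D₁ ≤ D := le_trans (le_trans (le_max_right _ _) (le_max_left _ _)) hD
  have hℓ3 : 3 ≤ ell D := hD₂ D (le_trans (le_max_right _ _) hD)
  have hℓ1 : 1 ≤ ell D := by linarith
  have h53D := l53_max (fun x hx => h53 D χ hD₅₃ hq hprim x hx)
  have hB0 : 0 ≤ B := (norm_nonneg _).trans (ha₁.1 0)
  have hK0 : 0 ≤ 16 * B ^ 2 * W * ell D ^ 674 := by positivity
  have hsum := outer_sum_le hℓ1 hK0 _ fun d _ =>
    inner_F_le c' hc53.le hC0 hℓ3 h53D ha₁.1 ha₂.1 hp d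
  calc _ ≤ 16 * B ^ 2 * W * ell D ^ 674 * (2 ^ 16 * ell D ^ 144) * (bigP D / bigT D ^ 2) := hsum
    _ = 2 ^ 20 * B ^ 2 * W * ell D ^ 818 * (bigP D / bigT D ^ 2) := by ring
    _ ≤ 1 * bigP D * bigT D ^ (-(1 : ℝ)) := absorb_le (hD₁ D hD₁')


/-! ## `Z22:(7.7)` and the tex-L1944 sentence, outright -/

/-- **`Z22:(7.7)` DISCHARGED outright**: `Σ*_ψ I₁(ψ) = (1/p)Σ_dΣ_{(l,p)=1}Σ_{(k,l)=1}(κ∗a₁)(dl)a₂(dk)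
k⁻¹(Σ*_ψ τ(ψ̄)ψ(l)ψ̄(k))Δ₁(l/(pk)) + O(PT⁻ᶜ)` — the tree's edge `eq77_of` (L2-t3) fed with
`Section7I1Line.step7u022_holds` (§7.u022, sz-d23/d03) and `hE77_holds`.
[cite: Zhang2022LandauSiegel, §7 (7.7) p. 36, tex L1935–L1942] -/
theorem eq77_holds : Eq77 c' :=
  eq77_of c' (Section7I1Line.step7u022_holds c') (hE77_holds c')

/-- **tex L1944 DISCHARGED outright** ("By trivial estimation, this remains valid if the constraint
`(l,p) = 1` is removed" — `Section7bStatements.Step7t1944 c′`, the cone leaf `h1944` of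
`Skeleton.theorem1_of_leaves_v*`): the tree's edge `step7t1944_of` fed with `eq77_holds` and
`hF77_holds`. [cite: Zhang2022LandauSiegel, §7 p. 36, tex L1944] -/
theorem step7t1944_holds : Step7t1944 c' :=
  step7t1944_of c' (eq77_holds c') (hF77_holds c')

/-- `Step7t1944` — `_holds` alias of `step7t1944_holds` above under the fact's exact name (appended
2026-08-28, D-0026 bookkeeping: the proof term is the existing theorem of this file; no statement,
definition or attribute is edited; no new named fact; the ledger's debt table listed the fact
unproved). [cite: Zhang2022LandauSiegel, §7 p. 36, tex L1944] -/
theorem _root_.Literature.NumberTheory.LFunctions.Zhang2022.Section7bStatements.Step7t1944_holds :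
    Step7t1944 c' :=
  _root_.Literature.NumberTheory.LFunctions.Zhang2022.Section7Eq77.step7t1944_holds (c' := c')

end Literature.NumberTheory.LFunctions.Zhang2022.Section7Eq77
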